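import Summits.Ventures.CertifiedQuantumChemistry.Rows.SlaterCondonFast
import HarnessLib

/-!
# Ventures/CertifiedQuantumChemistry — Rows/SlaterCondonFastBridge.lean: THE BRIDGE `FastTables.sc_eq` (bit-mask evaluator =
# `2·D·Model.slaterCondon`) and the far-pair guard `far4` (PART 2 of `Rows/SlaterCondonFast.lean`)

HONEST FRAMING (verbatim): certified bounds for a stated model Hamiltonian in a stated basis; not a
claim about the real molecule beyond that model.

var-2 (gen 16), zero compute, PROVED glue only (0 sorry, no claim node; nothing here asserts a bound about any model).
PART 1 (`Rows/SlaterCondonFast.lean`) defines the evaluator `FastTables.sc` and proves the three case bridges. Here: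

* **`FastTables.sc_eq`** — under the agreement hypothesis `hA` (tables = the model's integrals at scale `D`, `B = 2k ≤ 24`)
  and for masks `m, m' < 2^(2k)`: `(T.sc m m' : ℚ) = 2·D·F.slaterCondon (onv k m) (onv k m')`. The case split of
  `Model.slaterCondon` (`#(I \ J)`, `#(J \ I)` ∈ {1, 2}, `#I = #J`) is matched with the evaluator's `lowBit` tests through
  `card_bitSet_eq_one_iff` / `card_bitSet_eq_two_iff`, and `min'`/`max'` of the two-bit differences are read off the masks.
* for `clear1 x = x &&& (x − 1)` / `far4 x` of PART 1 (four `clear1` steps leave a bit ⇔ at least five set bits):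
  `card_bitSet_clear1`, `four_lt_card_of_far4` and `slaterCondon_onv_eq_zero_of_far4`: `far4 (m ^^^ m') → ⟨onv m| H_F |onv m'⟩ = 0` (more than two
  replacements; no electron-count hypothesis), so a row loop may skip such pairs before any evaluation.

Row feed and entry points: `Rows/CIFastRows.lean`.
-/

namespace Summit.Ventures.CertifiedQuantumChemistry

open Finset
open Literature.MathematicalPhysics.QuantumLattice Literature.MathematicalPhysics.QuantumChemistry

namespace FastTables

variable {k : ℕ} (T : FastTables)

section Bridge

variable {T} {F : Model k} {D : ℚ}
variable (hA : T.B = 2 * k ∧ 2 * k ≤ 24 ∧ (∀ p q : Fin k, (T.H p.val q.val : ℚ) = D * F.h p q) ∧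
    (∀ p q r s : Fin k, (T.V p.val q.val r.val s.val : ℚ) = D * F.eri p q r s) ∧ (T.E : ℚ) = 2 * D * F.ecore)
include hA

/-- **THE BRIDGE.** For tables agreeing with `F` at scale `D` and masks below `2^(2k)`:
`T.sc m m' = 2·D·⟨onv m| H_F |onv m'⟩`. -/
theorem sc_eq {m m' : ℕ} (hm : m < 2 ^ (2 * k)) (hm' : m' < 2 ^ (2 * k)) :
    (T.sc m m' : ℚ) = 2 * D * F.slaterCondon (Onv.onv k m) (Onv.onv k m') := by
  unfold sc scOne scTwo Model.slaterCondon
  by_cases hmm : m = m'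
  · subst hmm
    rw [if_pos rfl, if_pos rfl, diag_eq hA]
  have hne : Onv.onv k m ≠ Onv.onv k m' := fun h => hmm (Onv.eq_of_onv_eq hm hm' h)
  rw [if_neg hmm, if_neg hne]
  obtain ⟨ca, ha⟩ := card_sdiff_onv m m' hm
  obtain ⟨cb, hb⟩ := card_sdiff_onv m' m hm'
  rw [Nat.xor_comm m' m] at cb hb
  have hIJa : Onv.onv k m \ Onv.onv k m' = Onv.onv k (m &&& (m ^^^ m')) := Onv.onv_sdiff' _ _
  have hJIb : Onv.onv k m' \ Onv.onv k m = Onv.onv k (m' &&& (m ^^^ m')) := Onv.onv_sdiff _ _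
  set I := Onv.onv k m with hIdef
  set J := Onv.onv k m' with hJdef
  set a := m &&& (m ^^^ m') with hadef
  set b := m' &&& (m ^^^ m') with hbdef
  -- `a`, `b` are nonzero iff the differences are nonempty
  have a0 : a ≠ 0 ↔ (I \ J).card ≠ 0 := by
    rw [ca, not_iff_not]
    exact ⟨fun h => by rw [h, Onv.bitSet_zero, Finset.card_empty], fun h =>
      Onv.eq_zero_of_bitSet_eq_empty ha (Finset.card_eq_zero.1 h)⟩
  have b0 : b ≠ 0 ↔ (J \ I).card ≠ 0 := by
    rw [cb, not_iff_not]
    exact ⟨fun h => by rw [h, Onv.bitSet_zero, Finset.card_empty], fun h =>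
      Onv.eq_zero_of_bitSet_eq_empty hb (Finset.card_eq_zero.1 h)⟩
  -- one replacement on each side
  have key1 : (a ≠ 0 ∧ b ≠ 0 ∧ Onv.lowBit a = a ∧ Onv.lowBit b = b) ↔ ((I \ J).card = 1 ∧ (J \ I).card = 1) := by
    constructor
    · rintro ⟨ha0, hb0, hla, hlb⟩
      exact ⟨ca ▸ (Onv.card_bitSet_eq_one_iff ha0 ha).2 hla, cb ▸ (Onv.card_bitSet_eq_one_iff hb0 hb).2 hlb⟩
    · rintro ⟨h1, h2⟩
      have ha0 : a ≠ 0 := a0.2 (by omega)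
      have hb0 : b ≠ 0 := b0.2 (by omega)
      exact ⟨ha0, hb0, (Onv.card_bitSet_eq_one_iff ha0 ha).1 (ca ▸ h1), (Onv.card_bitSet_eq_one_iff hb0 hb).1 (cb ▸ h2)⟩
  have slow1 : (I.card = J.card ∧ (J \ I).card = 1) ↔ ((I \ J).card = 1 ∧ (J \ I).card = 1) := by
    rw [← card_sdiff_eq_iff I J]
    constructor
    · rintro ⟨h, h'⟩; exact ⟨by omega, h'⟩
    · rintro ⟨h, h'⟩; exact ⟨by omega, h'⟩
  by_cases h1 : (I \ J).card = 1 ∧ (J \ I).card = 1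
  · -- SINGLE
    rw [if_pos (key1.2 h1), if_pos (slow1.2 h1)]
    obtain ⟨Pa, hPa, hIa⟩ := exists_orb_of_card_eq_one ha (ca ▸ h1.1)
    obtain ⟨Pb, hPb, hJb⟩ := exists_orb_of_card_eq_one hb (cb ▸ h1.2)
    have hbJ : Pb ∈ J \ I := by rw [hJIb, hJb]; exact Finset.mem_singleton_self _
    rw [hIJa, hJIb, hIa, hJb, Finset.sum_singleton, Finset.sum_singleton, hPa, hPb]
    exact single_eq hA hm' Pa (Onv.mem_onv.1 (Finset.mem_sdiff.1 hbJ).1)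
  rw [if_neg (show ¬(a ≠ 0 ∧ b ≠ 0 ∧ Onv.lowBit a = a ∧ Onv.lowBit b = b) from fun h => h1 (key1.1 h)),
    if_neg (show ¬(I.card = J.card ∧ (J \ I).card = 1) from fun h => h1 (slow1.1 h))]
  -- two replacements on each side
  have xa : ∀ {x : ℕ}, x ^^^ Onv.lowBit x ≠ 0 → x ≠ 0 ∧ Onv.lowBit x ≠ x := by
    intro x hx
    refine ⟨fun h => hx ?_, fun h => hx ?_⟩
    · rw [h, Onv.lowBit_zero]; rfl
    · rw [h, Nat.xor_self]
  have key2 : (a ^^^ Onv.lowBit a ≠ 0 ∧ b ^^^ Onv.lowBit b ≠ 0 ∧ Onv.lowBit (a ^^^ Onv.lowBit a) = a ^^^ Onv.lowBit a ∧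
      Onv.lowBit (b ^^^ Onv.lowBit b) = b ^^^ Onv.lowBit b) ↔ ((I \ J).card = 2 ∧ (J \ I).card = 2) := by
    constructor
    · rintro ⟨ha2, hb2, hla, hlb⟩
      obtain ⟨ha0, hna⟩ := xa ha2
      obtain ⟨hb0, hnb⟩ := xa hb2
      exact ⟨ca ▸ (Onv.card_bitSet_eq_two_iff ha0 ha hna).2 hla, cb ▸ (Onv.card_bitSet_eq_two_iff hb0 hb hnb).2 hlb⟩
    · rintro ⟨h2a, h2b⟩
      have ha0 : a ≠ 0 := a0.2 (by omega)
      have hb0 : b ≠ 0 := b0.2 (by omega)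
      have hna : Onv.lowBit a ≠ a := fun h => by
        have := (Onv.card_bitSet_eq_one_iff ha0 ha).2 h; omega
      have hnb : Onv.lowBit b ≠ b := fun h => by
        have := (Onv.card_bitSet_eq_one_iff hb0 hb).2 h; omega
      refine ⟨fun h => hna ?_, fun h => hnb ?_, (Onv.card_bitSet_eq_two_iff ha0 ha hna).1 (ca ▸ h2a),
        (Onv.card_bitSet_eq_two_iff hb0 hb hnb).1 (cb ▸ h2b)⟩
      · have e : a = (a ^^^ Onv.lowBit a) ^^^ Onv.lowBit a := by rw [Nat.xor_assoc, Nat.xor_self, Nat.xor_zero]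
        rw [h, Nat.zero_xor] at e; exact e.symm
      · have e : b = (b ^^^ Onv.lowBit b) ^^^ Onv.lowBit b := by rw [Nat.xor_assoc, Nat.xor_self, Nat.xor_zero]
        rw [h, Nat.zero_xor] at e; exact e.symm
  have slow2 : (1 < (J \ I).card ∧ 1 < (I \ J).card ∧ (J \ I).card = 2 ∧ I.card = J.card) ↔
      ((I \ J).card = 2 ∧ (J \ I).card = 2) := by
    rw [← card_sdiff_eq_iff I J]
    constructor
    · rintro ⟨-, -, h, h'⟩; exact ⟨by omega, h⟩
    · rintro ⟨h, h'⟩; exact ⟨by omega, by omega, h', by omega⟩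
  by_cases h2 : (I \ J).card = 2 ∧ (J \ I).card = 2
  · -- DOUBLE
    rw [if_pos (key2.2 h2), dif_pos (slow2.2 h2)]
    obtain ⟨P1, P2, hP1, hP2, hP12, hIa⟩ := exists_orb_of_card_eq_two ha (ca ▸ h2.1)
    obtain ⟨Q1, Q2, hQ1, hQ2, hQ12, hJb⟩ := exists_orb_of_card_eq_two hb (cb ▸ h2.2)
    have p12 : Onv.pos P1 < Onv.pos P2 := Onv.pos_lt_pos.2 hP12
    have q12 : Onv.pos Q1 < Onv.pos Q2 := Onv.pos_lt_pos.2 hQ12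
    have haX : a = 2 ^ Onv.pos P1 ^^^ 2 ^ Onv.pos P2 := by
      rw [← hP1, ← hP2, Nat.xor_comm a, ← Nat.xor_assoc, Nat.xor_self, Nat.zero_xor]
    have hbX : b = 2 ^ Onv.pos Q1 ^^^ 2 ^ Onv.pos Q2 := by
      rw [← hQ1, ← hQ2, Nat.xor_comm b, ← Nat.xor_assoc, Nat.xor_self, Nat.zero_xor]
    have mmI : ∀ h, (I \ J).min' h = P1 := fun h => by
      have h' : (Onv.onv k (2 ^ Onv.pos P1 ^^^ 2 ^ Onv.pos P2)).Nonempty := by rw [← haX, ← hIJa]; exact h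
      rw [show (I \ J).min' h = (Onv.onv k (2 ^ Onv.pos P1 ^^^ 2 ^ Onv.pos P2)).min' h' by simp only [hIJa, haX],
        (Onv.min'_max'_onv_two p12 (Onv.pos_lt P2) h').1, Onv.orbAt_pos]
    have mxI : ∀ h, (I \ J).max' h = P2 := fun h => by
      have h' : (Onv.onv k (2 ^ Onv.pos P1 ^^^ 2 ^ Onv.pos P2)).Nonempty := by rw [← haX, ← hIJa]; exact h
      rw [show (I \ J).max' h = (Onv.onv k (2 ^ Onv.pos P1 ^^^ 2 ^ Onv.pos P2)).max' h' by simp only [hIJa, haX],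
        (Onv.min'_max'_onv_two p12 (Onv.pos_lt P2) h').2, Onv.orbAt_pos]
    have mmJ : ∀ h, (J \ I).min' h = Q1 := fun h => by
      have h' : (Onv.onv k (2 ^ Onv.pos Q1 ^^^ 2 ^ Onv.pos Q2)).Nonempty := by rw [← hbX, ← hJIb]; exact h
      rw [show (J \ I).min' h = (Onv.onv k (2 ^ Onv.pos Q1 ^^^ 2 ^ Onv.pos Q2)).min' h' by simp only [hJIb, hbX],
        (Onv.min'_max'_onv_two q12 (Onv.pos_lt Q2) h').1, Onv.orbAt_pos]
    have mxJ : ∀ h, (J \ I).max' h = Q2 := fun h => by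
      have h' : (Onv.onv k (2 ^ Onv.pos Q1 ^^^ 2 ^ Onv.pos Q2)).Nonempty := by rw [← hbX, ← hJIb]; exact h
      rw [show (J \ I).max' h = (Onv.onv k (2 ^ Onv.pos Q1 ^^^ 2 ^ Onv.pos Q2)).max' h' by simp only [hJIb, hbX],
        (Onv.min'_max'_onv_two q12 (Onv.pos_lt Q2) h').2, Onv.orbAt_pos]
    rw [mmI, mxI, mmJ, mxJ, hP2, hP1, hQ2, hQ1]
    have mP1 : P1 ∈ I \ J := by rw [hIJa, hIa]; simp
    have mP2 : P2 ∈ I \ J := by rw [hIJa, hIa]; simp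
    have mQ1 : Q1 ∈ J \ I := by rw [hJIb, hJb]; simp
    have mQ2 : Q2 ∈ J \ I := by rw [hJIb, hJb]; simp
    refine double_eq hA hm' (Onv.mem_onv.1 (Finset.mem_sdiff.1 mQ1).1) (Onv.mem_onv.1 (Finset.mem_sdiff.1 mQ2).1)
      hQ12.ne ?_ ?_ hP12.ne
    · have h := (Finset.mem_sdiff.1 mP1).2
      rw [hJdef, Onv.mem_onv] at h; simpa using h
    · have h := (Finset.mem_sdiff.1 mP2).2
      rw [hJdef, Onv.mem_onv] at h; simpa using h
  · rw [if_neg (show ¬(a ^^^ Onv.lowBit a ≠ 0 ∧ b ^^^ Onv.lowBit b ≠ 0 ∧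
        Onv.lowBit (a ^^^ Onv.lowBit a) = a ^^^ Onv.lowBit a ∧ Onv.lowBit (b ^^^ Onv.lowBit b) = b ^^^ Onv.lowBit b)
        from fun h => h2 (key2.1 h)),
      dif_neg (show ¬(1 < (J \ I).card ∧ 1 < (I \ J).card ∧ (J \ I).card = 2 ∧ I.card = J.card)
        from fun h => h2 (slow2.1 h)), Int.cast_zero, mul_zero]

end Bridge


/-! ## Skipping far pairs -/

/-- `clear1` removes exactly one bit from a nonzero `x < 2^B`. -/
theorem card_bitSet_clear1 {x B : ℕ} (hx : x ≠ 0) (hB : x < 2 ^ B) :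
    (Onv.bitSet (clear1 x) B).card + 1 = (Onv.bitSet x B).card ∧ clear1 x < 2 ^ B := by
  obtain ⟨j, c, rfl⟩ := Onv.exists_decomp hx
  obtain ⟨hj, -⟩ := Onv.decomp_bounds hB
  have := Nat.two_pow_pos j
  rw [clear1, Onv.land_pred_of_decomp, Onv.card_bitSet_decomp j c B hj, Onv.bitSet_two_pow_succ_mul, card_map]
  exact ⟨rfl, by omega⟩

/-- `far4 x → 4 < #bits(x)` for `x < 2^B`. -/
theorem four_lt_card_of_far4 {x B : ℕ} (hB : x < 2 ^ B) (h : far4 x = true) : 4 < (Onv.bitSet x B).card := by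
  have step : ∀ {y : ℕ}, y < 2 ^ B → clear1 y ≠ 0 →
      (Onv.bitSet (clear1 y) B).card + 1 = (Onv.bitSet y B).card ∧ clear1 y < 2 ^ B := by
    intro y hy hc
    have hy0 : y ≠ 0 := by rintro rfl; simp [clear1] at hc
    exact card_bitSet_clear1 hy0 hy
  have nz4 : clear1 (clear1 (clear1 (clear1 x))) ≠ 0 := by simpa [far4] using h
  have nz3 : clear1 (clear1 (clear1 x)) ≠ 0 := fun h0 => nz4 (by rw [h0]; rfl)
  have nz2 : clear1 (clear1 x) ≠ 0 := fun h0 => nz3 (by rw [h0]; rfl)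
  have nz1 : clear1 x ≠ 0 := fun h0 => nz2 (by rw [h0]; rfl)
  obtain ⟨c1, l1⟩ := step hB nz1
  obtain ⟨c2, l2⟩ := step l1 nz2
  obtain ⟨c3, l3⟩ := step l2 nz3
  obtain ⟨c4, l4⟩ := step l3 nz4
  have c5 : 1 ≤ (Onv.bitSet (clear1 (clear1 (clear1 (clear1 x)))) B).card := by
    rw [Nat.one_le_iff_ne_zero]
    intro h0
    exact nz4 (Onv.eq_zero_of_bitSet_eq_empty l4 (Finset.card_eq_zero.1 h0))
  omega

/-- **Far pairs vanish**: if `m ^^^ m'` has at least five set bits then `⟨onv m| H_F |onv m'⟩ = 0` (more than two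
replacements; no electron-count hypothesis needed). -/
theorem slaterCondon_onv_eq_zero_of_far4 (F : Model k) {m m' : ℕ} (hm : m < 2 ^ (2 * k)) (hm' : m' < 2 ^ (2 * k))
    (h : far4 (m ^^^ m') = true) : F.slaterCondon (Onv.onv k m) (Onv.onv k m') = 0 := by
  set I := Onv.onv k m with hIdef
  set J := Onv.onv k m' with hJdef
  have hx : m ^^^ m' < 2 ^ (2 * k) := Nat.xor_lt_two_pow hm hm'
  have h5 := four_lt_card_of_far4 hx h
  -- `#bits(m ^^^ m') = #(I \ J) + #(J \ I)`
  have hsymm : Onv.onv k (m ^^^ m') = (I \ J) ∪ (J \ I) := by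
    ext P
    rw [Onv.mem_onv, Nat.testBit_xor, Finset.mem_union, Finset.mem_sdiff, Finset.mem_sdiff, hIdef, hJdef,
      Onv.mem_onv, Onv.mem_onv]
    cases m.testBit (Onv.pos P) <;> cases m'.testBit (Onv.pos P) <;> simp
  have hcard : (Onv.bitSet (m ^^^ m') (2 * k)).card = (I \ J).card + (J \ I).card := by
    rw [← Onv.card_onv, hsymm, Finset.card_union_of_disjoint disjoint_sdiff_sdiff]
  rw [hcard] at h5
  by_cases hJ : 2 < (J \ I).card
  · exact Model.slaterCondon_eq_zero_of_two_lt_card_sdiff F hJ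
  · have hI : 2 < (I \ J).card := by omega
    have hc := card_sdiff_eq_iff I J
    unfold Model.slaterCondon
    have hne : I ≠ J := by rintro h; simp [h] at hI
    rw [if_neg hne, if_neg (fun h => by rw [← hc] at h; omega), dif_neg (fun h => by rw [← hc] at h; omega)]

end FastTables

end Summit.Ventures.CertifiedQuantumChemistry
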